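import Summits.BirchSwinnertonDyer.BirchSwinnertonDyer.Theorems.ThetaPartnerAtTwoSignedControlAtTwoPlusTowerTwo
import Literature.NumberTheory.EllipticCurves.CyclotomicZpExtensionLayerOneSqrtTwoProofs
import Literature.NumberTheory.EllipticCurves.Kobayashi2003.SignedSelmer
import Literature.NumberTheory.GaloisRepresentations.AbsGaloisRestrictCyclotomic
import HarnessLib

/-!
# The `ℤ₂`-LAYERS AT `2` of the cyclotomic `ℤ₂`-extension, I (Galois groups): `2ⁿ ∣ ℓ(u) ⟺ u ≡ ±1 (mod 2^{n+2})`,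
# `Gal(ℚ̄/ℚ_n) = {σ : σζ_{2^{n+2}} = ζ_{2^{n+2}}^{±1}} = Stab(ζ_{2^{n+2}} + ζ_{2^{n+2}}⁻¹)`, and `Gal(Ē/ℚ_n·E) = Stab_{Γ_E}(ζ' + ζ'⁻¹)`
# for every `ℚ`-field `E`, every embedding `ι : ℚ̄ → Ē` and every primitive `2^{n+2}`-th root of unity `ζ' ∈ Ē`
# (K4 `SignedControlAtTwo`, stmt-BirchSwinnertonDyer-20309, line `eulerchar` v6, typing prerequisite of the stub HONDA⁺@2)

Route `ThetaPartnerAtTwo` (TP2; crux shared with `ResidualThetaTransportAtTwo`), crux K4, line `eulerchar` v6 (lead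
`prover-bsd-wall-tp2-p3` g2); seat `prover-bsd-wall-tp2-p3-w2` (width seat 2/3, g2).

WHY. The one research stub of v6, `stub_plusHondaSystemTwo` (HONDA⁺@2), asks for points `d_m ∈ E(ℚ_{2,m}·ℚ_v)`
(`localLayerPointsOfEmb κ ι W m` for the CYCLOTOMIC `κ : ZpExtension ℚ 2`) with trace relations in the currency
`localTraceOfEmb κ ι W (m+1) (m+2)`. The construction (lead's memo `Cruxes/SignedControlAtTwo/LAGPLUS-AT-2-CONSTRUCTION.md`,
K3 lead's `…SignedKatoUpToAtTwoLocalTwoRealTrace`) produces them as `Δ`-traces `e_n = c_{n+2} + σ₀·c_{n+2}` of Kobayashi's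
`μ`-tower points over `ℚ₂(ζ_{2^{n+2}})`, with trace sums over `Stab ζ_{2^{m}} / Stab ζ_{2^{m+1}}` (`PadicCyclotomicTower.stab`).
This file and its sequel `…PlusLayerTwoPoints` are the dictionary between the two currencies — the «typing prerequisite» of the
lead's 2026-08-27 plan: the `n`-th layer of the cyclotomic `ℤ₂`-extension of `ℚ` is `ℚ_n = ℚ(ζ_{2^{n+2}})⁺`, cut out in `Γ_ℚ` by
`χ₂(σ) ≡ ±1 (mod 2^{n+2})` (this file: the Galois groups, any model; the sequel: the model `ℚ_[2]`, layer points, layer traces).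

WHAT (THEOREMS ONLY; `κ : ZpExtension ℚ 2` cyclotomic throughout):
* §1 (`2`-adic units) `pow_dvd_ell_two_iff`: **`2ⁿ ∣ ℓ(u) ⟺ u ≡ ±1 (mod 2^{n+2})`** for the normalised logarithm `ℓ`
  of `CyclotomicZpExtension.lean` (`5^{2ℓ(u)} = u²`; the tree had `⟸` for `u ≡ 1` and `⟹` only at `n = 1`).
* §2 (global) `mem_layerSubgroup_two_iff`: **`σ ∈ Gal(ℚ̄/ℚ_n) ⟺ σζ = ζ ∨ σζ = ζ⁻¹`** for any primitive
  `2^{n+2}`-th root of unity `ζ ∈ ℚ̄`; `…_iff_smul_add_inv`, `layerSubgroup_two_eq_stabilizer`: `Gal(ℚ̄/ℚ_n) = Stab(ζ + ζ⁻¹)`.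
* §3 (local, any `ℚ`-field `E`, any `ι : ℚ̄ → Ē`) `mem_localLayerSubgroupOfEmb_two_iff`: **`τ ∈ Gal(Ē/ℚ_n·E) ⟺ τζ' = ζ'^{±1}`**
  for ANY primitive `2^{n+2}`-th root `ζ' ∈ Ē`; `localLayerSubgroupOfEmb_two_eq_stabilizer`.
  `smul_eq_self_of_smul_pow_eq_self_of_mem` (`Stab ζ'^{2^{n−m}} ∩ Gal(Ē/ℚ_n·E) = Stab ζ'`, element form).

HONEST FRAMING: THEOREMS ONLY (no definition, no named fact, no instance, no `sorry`), route-independent (no `Theses`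
import); Galois bookkeeping of the cyclotomic `ℤ₂`-tower, nothing about any elliptic curve or Selmer group; closes no item;
BSD is not proved by any of this.

References: [Washington1997] L. C. Washington, *Introduction to Cyclotomic Fields*, 2nd ed., §13.1 (`ℚ_∞ ⊂ ℚ(μ_{2^∞})` is the
fixed field of `{±1}`, `ℚ_n = ℚ(ζ_{2^{n+2}})⁺`), Prop. 2.16; [Serre1973] J.-P. Serre, *A Course in Arithmetic*, Ch. II §3.2
Prop. 8 (`ℤ₂ˣ = {±1} × (1 + 4ℤ₂)`, `1 + 4ℤ₂ = 5^{ℤ₂}`); [Kobayashi2003] S. Kobayashi, Invent. Math. 152 (2003), Def. 1.1,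
§8.4; [NeukirchANT1999] Ch. IV §1.
-/

set_option autoImplicit false
-- the Theorems namespace of this sub repeats the summit name by design (D-0017 nested layout)
set_option linter.dupNamespace false

noncomputable section

open scoped Classical

namespace Summit.BirchSwinnertonDyer.BirchSwinnertonDyer.Theorems.SignedEC.PlusLayer

open Field Literature.NumberTheory.EllipticCurves Literature.NumberTheory.EllipticCurves.CyclotomicZp
  Literature.NumberTheory.EllipticCurves.PadicOneUnits Literature.NumberTheory.GaloisRepresentations
  Literature.NumberTheory.EllipticCurves.ZpExtension Literature.NumberTheory.EllipticCurves.Kobayashi2003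

/-! ## §1 `2`-adic units: `2ⁿ ∣ ℓ(u) ⟺ u ≡ ±1 (mod 2^{n+2})` -/

section Units

/-- At `p = 2` the cyclotomic exponent is `2` (`γ_cyc = 1 + 2² = 5`). [folklore] -/
private theorem cyclotomicExponent_two : cyclotomicExponent 2 = 2 := by
  unfold cyclotomicExponent; simp

/-- At `p = 2` the torsion order `#μ(ℤ₂)` is `2`. [folklore] -/
private theorem torsionOrder_two : torsionOrder 2 = 2 := by
  rw [torsionOrder, cyclotomicExponent_two]; decide

/-- A unit of `ℤ₂` is `≡ 1 (mod 2)`. [folklore] -/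
theorem two_dvd_units_sub_one (u : ℤ_[2]ˣ) : (2 : ℤ_[2]) ∣ (u : ℤ_[2]) - 1 := by
  have hk : (u : ℤ_[2]) - 1 ∈ RingHom.ker (PadicInt.toZMod (p := 2)) := by
    rw [RingHom.mem_ker, map_sub, map_one, sub_eq_zero]
    have hu : IsUnit (PadicInt.toZMod (p := 2) (u : ℤ_[2])) := (Units.isUnit u).map _
    have hne : PadicInt.toZMod (p := 2) (u : ℤ_[2]) ≠ 0 := hu.ne_zero
    have key : ∀ w : ZMod 2, w ≠ 0 → w = 1 := by decide
    exact key _ hne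
  rw [PadicInt.ker_toZMod, PadicInt.maximalIdeal_eq_span_p, Ideal.mem_span_singleton] at hk
  exact_mod_cast hk

/-- **`2ⁿ ∣ ℓ(u) ⟹ u² ≡ 1 (mod 2^{n+3})`**: with `y = 2ℓ(u) ∈ 2^{n+1}ℤ₂` and `5^y = u²`, `‖u² − 1‖ = ‖5^y − 1‖ = ‖y‖·‖4‖ ≤ ‖2^{n+3}‖`.
[cite: Serre1973, Ch. II §3.2 Prop. 8] -/
theorem pow_dvd_sq_sub_one_of_pow_dvd_ell (u : ℤ_[2]ˣ) {n : ℕ} (h : (2 : ℤ_[2]) ^ n ∣ ell 2 u) :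
    (2 : ℤ_[2]) ^ (n + 3) ∣ (u : ℤ_[2]) ^ 2 - 1 := by
  set y : ℤ_[2] := torsionOrder 2 * ell 2 u with hy
  have h1 : cycPow 2 y = (u : ℤ_[2]) ^ torsionOrder 2 := cycPow_torsionOrder_mul_ell 2 u
  have h2 : ‖cycPow 2 y - 1‖ = ‖y‖ * ‖((2 : ℕ) : ℤ_[2]) ^ (cyclotomicExponent 2 - 1 + 1)‖ :=
    norm_oneAddPow_sub_one (p := 2) (cyclotomicExponent 2 - 1) (cyclotomicExponent_cond 2) y
  rw [cyclotomicExponent_two, show (2 - 1 + 1 : ℕ) = 2 from rfl, Nat.cast_ofNat] at h2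
  obtain ⟨x, hx⟩ := h
  have hy' : y = (2 : ℤ_[2]) ^ (n + 1) * x := by
    rw [hy, hx, torsionOrder_two, Nat.cast_ofNat]; ring
  have hny : ‖y‖ ≤ ‖(2 : ℤ_[2]) ^ (n + 1)‖ := by
    rw [hy', norm_mul]
    exact mul_le_of_le_one_right (norm_nonneg _) (PadicInt.norm_le_one x)
  rw [torsionOrder_two] at h1
  refine dvd_of_norm_le (pow_ne_zero _ two_ne_zero) ?_
  calc ‖(u : ℤ_[2]) ^ 2 - 1‖ = ‖y‖ * ‖(2 : ℤ_[2]) ^ 2‖ := by rw [← h1, h2]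
    _ ≤ ‖(2 : ℤ_[2]) ^ (n + 1)‖ * ‖(2 : ℤ_[2]) ^ 2‖ := mul_le_mul_of_nonneg_right hny (norm_nonneg _)
    _ = ‖(2 : ℤ_[2]) ^ (n + 3)‖ := by rw [← norm_mul, ← pow_add]

/-- **`u² ≡ 1 (mod 2^{n+3}) ⟹ u ≡ ±1 (mod 2^{n+2})`** for a unit `u = 1 + 2a` of `ℤ₂`: `u² − 1 = 4a(a+1)` and one of `a`,
`a + 1` is a unit of the local ring `ℤ₂`. [cite: Serre1973, Ch. II §3.2 Prop. 8] -/
theorem pow_dvd_sub_one_or_add_one_of_sq (u : ℤ_[2]ˣ) {n : ℕ} (h : (2 : ℤ_[2]) ^ (n + 3) ∣ (u : ℤ_[2]) ^ 2 - 1) :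
    (2 : ℤ_[2]) ^ (n + 2) ∣ (u : ℤ_[2]) - 1 ∨ (2 : ℤ_[2]) ^ (n + 2) ∣ (u : ℤ_[2]) + 1 := by
  obtain ⟨a, ha⟩ := two_dvd_units_sub_one u
  have hu2 : (u : ℤ_[2]) + 1 = 2 * (a + 1) := by linear_combination ha
  have hsq : (u : ℤ_[2]) ^ 2 - 1 = (2 : ℤ_[2]) ^ 2 * (a * (a + 1)) := by
    have e : (u : ℤ_[2]) ^ 2 - 1 = ((u : ℤ_[2]) - 1) * ((u : ℤ_[2]) + 1) := by ring
    rw [e, ha, hu2]; ring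
  rw [hsq, show n + 3 = 2 + (n + 1) by omega, pow_add] at h
  have h' : (2 : ℤ_[2]) ^ (n + 1) ∣ a * (a + 1) := (mul_dvd_mul_iff_left (pow_ne_zero 2 two_ne_zero)).mp h
  rcases IsLocalRing.isUnit_or_isUnit_one_sub_self (-a) with hua | hua
  · -- `a` is a unit: `2^{n+1} ∣ a + 1`
    right
    have hua' : IsUnit a := by simpa using hua.neg
    rw [hu2, pow_succ']
    exact mul_dvd_mul_left 2 (hua'.dvd_mul_left.mp h')
  · -- `1 + a` is a unit: `2^{n+1} ∣ a`
    left
    have hua' : IsUnit (a + 1) := by rw [add_comm]; simpa using hua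
    rw [ha, pow_succ']
    exact mul_dvd_mul_left 2 (hua'.dvd_mul_right.mp h')

/-- `ℓ(−u) = ℓ(u)` (`−1 ∈ μ(ℤ₂) = ker ℓ`). [folklore] -/
theorem ell_neg (u : ℤ_[2]ˣ) : ell 2 (-u) = ell 2 u := by
  rw [← neg_one_mul, ell_mul, (ell_eq_zero_iff 2 (-1)).mpr ?_, zero_add]
  exact isOfFinOrder_iff_pow_eq_one.mpr ⟨2, two_pos, by simp⟩

/-- **`2ⁿ ∣ ℓ(u) ⟺ u ≡ ±1 (mod 2^{n+2})`** for a unit `u` of `ℤ₂` and the normalised logarithm `ℓ` (`5^{2ℓ(u)} = u²`):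
`ℓ` identifies `ℤ₂ˣ/{±1} ≅ ℤ₂` and carries the filtration `{±1}·(1 + 2^{n+2}ℤ₂)` to `2ⁿℤ₂`. [cite: Serre1973, Ch. II §3.2 Prop. 8]
[cite: Washington1997, §13.1] -/
theorem pow_dvd_ell_two_iff (u : ℤ_[2]ˣ) (n : ℕ) :
    (2 : ℤ_[2]) ^ n ∣ ell 2 u ↔
      (2 : ℤ_[2]) ^ (n + 2) ∣ (u : ℤ_[2]) - 1 ∨ (2 : ℤ_[2]) ^ (n + 2) ∣ (u : ℤ_[2]) + 1 := by
  refine ⟨fun h ↦ pow_dvd_sub_one_or_add_one_of_sq u (pow_dvd_sq_sub_one_of_pow_dvd_ell u h), fun h ↦ ?_⟩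
  rcases h with h | h
  · exact pow_dvd_ell_of_norm_sub_one_le_two u n (norm_le_of_dvd h)
  · rw [← ell_neg]
    refine pow_dvd_ell_of_norm_sub_one_le_two (-u) n (norm_le_of_dvd ?_)
    rw [Units.val_neg, show -(u : ℤ_[2]) - 1 = -((u : ℤ_[2]) + 1) by ring]
    exact (dvd_neg).mpr h

end Units

/-! ## §2 Global: `Gal(ℚ̄/ℚ_n) = {σ : σζ_{2^{n+2}} = ζ_{2^{n+2}}^{±1}} = Stab(ζ_{2^{n+2}} + ζ_{2^{n+2}}⁻¹)` -/

section Global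

variable {n : ℕ} {ζ : AlgebraicClosure ℚ}

/-- `σζ = ζ ⟺ χ₂(σ) ≡ 1 (mod 2^{n+2})` for a primitive `2^{n+2}`-th root of unity `ζ ∈ ℚ̄`. [folklore] -/
theorem smul_eq_self_iff_pow_dvd_cyclotomicCharacter_sub_one (hζ : IsPrimitiveRoot ζ (2 ^ (n + 2)))
    (σ : absoluteGaloisGroup ℚ) :
    σ • ζ = ζ ↔ (2 : ℤ_[2]) ^ (n + 2) ∣ ((GaloisRep.cyclotomicCharacter ℚ 2 σ : ℤ_[2]ˣ) : ℤ_[2]) - 1 := by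
  have hspec := GaloisRep.cyclotomicCharacter_spec ℚ 2 (k := n + 2) σ ζ hζ.pow_eq_one
  set x := (GaloisRep.cyclotomicCharacter ℚ 2 σ).val.toZModPow (n + 2) with hx
  have hlt : 1 < 2 ^ (n + 2) := Nat.one_lt_pow (Nat.succ_ne_zero _) one_lt_two
  haveI : Fact (1 < 2 ^ (n + 2)) := ⟨hlt⟩
  rw [← Ideal.mem_span_singleton, show (2 : ℤ_[2]) = ((2 : ℕ) : ℤ_[2]) from (Nat.cast_ofNat).symm,
    ← PadicInt.ker_toZModPow, RingHom.mem_ker, map_sub, map_one, sub_eq_zero, hspec]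
  change ζ ^ x.val = ζ ↔ x = 1
  constructor
  · intro h
    apply ZMod.val_injective
    rw [ZMod.val_one]
    refine (hζ.pow_inj (ZMod.val_lt _) hlt ?_)
    rw [pow_one]; exact h
  · intro h
    rw [h, ZMod.val_one, pow_one]

/-- `σζ = ζ⁻¹ ⟺ χ₂(σ) ≡ −1 (mod 2^{n+2})` for a primitive `2^{n+2}`-th root of unity `ζ ∈ ℚ̄`. [folklore] -/
theorem smul_eq_inv_iff_pow_dvd_cyclotomicCharacter_add_one (hζ : IsPrimitiveRoot ζ (2 ^ (n + 2)))
    (σ : absoluteGaloisGroup ℚ) :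
    σ • ζ = ζ⁻¹ ↔ (2 : ℤ_[2]) ^ (n + 2) ∣ ((GaloisRep.cyclotomicCharacter ℚ 2 σ : ℤ_[2]ˣ) : ℤ_[2]) + 1 := by
  have hspec := GaloisRep.cyclotomicCharacter_spec ℚ 2 (k := n + 2) σ ζ hζ.pow_eq_one
  set x := (GaloisRep.cyclotomicCharacter ℚ 2 σ).val.toZModPow (n + 2) with hx
  haveI : NeZero (2 ^ (n + 2)) := ⟨pow_ne_zero _ two_ne_zero⟩
  rw [← Ideal.mem_span_singleton, show (2 : ℤ_[2]) = ((2 : ℕ) : ℤ_[2]) from (Nat.cast_ofNat).symm,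
    ← PadicInt.ker_toZModPow, RingHom.mem_ker, map_add, map_one, hspec]
  change ζ ^ x.val = ζ⁻¹ ↔ x + 1 = 0
  rw [← mul_eq_one_iff_eq_inv₀ (hζ.ne_zero (pow_ne_zero _ two_ne_zero)), ← pow_succ, hζ.pow_eq_one_iff_dvd,
    ← ZMod.natCast_eq_zero_iff, Nat.cast_succ, ZMod.natCast_zmod_val]

/-- **`Gal(ℚ̄/ℚ_n) = {σ : σζ = ζ ∨ σζ = ζ⁻¹}` for the NORMALISED cyclotomic `ℤ₂`-extension `κ_cyc = ℓ ∘ χ₂`** and any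
primitive `2^{n+2}`-th root of unity `ζ ∈ ℚ̄` (`ℚ_n = ℚ(ζ_{2^{n+2}})⁺`). [cite: Washington1997, §13.1] -/
theorem mem_layerSubgroup_zpExtension_two_iff (hζ : IsPrimitiveRoot ζ (2 ^ (n + 2))) (σ : absoluteGaloisGroup ℚ) :
    σ ∈ (CyclotomicZp.zpExtension 2).layerSubgroup n ↔ σ • ζ = ζ ∨ σ • ζ = ζ⁻¹ := by
  rw [mem_layerSubgroup, zpExtension_apply, toAdd_ofAdd, Nat.cast_ofNat, pow_dvd_ell_two_iff,
    smul_eq_self_iff_pow_dvd_cyclotomicCharacter_sub_one hζ, smul_eq_inv_iff_pow_dvd_cyclotomicCharacter_add_one hζ]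

variable {κ : ZpExtension ℚ 2}

/-- **`Gal(ℚ̄/ℚ_n) = {σ : σζ = ζ ∨ σζ = ζ⁻¹}` for EVERY cyclotomic `ℤ₂`-extension `κ` of `ℚ`** (a unit twist of `κ_cyc`;
unit twists do not move the layers) and any primitive `2^{n+2}`-th root of unity `ζ ∈ ℚ̄`. [cite: Washington1997, §13.1] -/
theorem mem_layerSubgroup_two_iff (hκ : κ.IsCyclotomic) (hζ : IsPrimitiveRoot ζ (2 ^ (n + 2)))
    (σ : absoluteGaloisGroup ℚ) : σ ∈ κ.layerSubgroup n ↔ σ • ζ = ζ ∨ σ • ζ = ζ⁻¹ := by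
  obtain ⟨u, rfl⟩ := IsCyclotomic.exists_eq_unitTwist_holds (CyclotomicZp.isCyclotomic_zpExtension 2) hκ
  rw [layerSubgroup_unitTwist]
  exact mem_layerSubgroup_zpExtension_two_iff hζ σ

/-- `σζ = ζ ∨ σζ = ζ⁻¹ ⟺ σ(ζ + ζ⁻¹) = ζ + ζ⁻¹` (`σ` acts by field automorphisms). [cite: Washington1997, Prop. 2.16] -/
theorem smul_eq_or_smul_eq_inv_iff_smul_add_inv {F : Type*} [Field F] (σ : absoluteGaloisGroup F)
    {x : AlgebraicClosure F} (hx : x ≠ 0) : σ • x = x ∨ σ • x = x⁻¹ ↔ σ • (x + x⁻¹) = x + x⁻¹ := by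
  rw [smul_add, smul_inv'', PlusTower.add_inv_eq_add_inv_iff ((smul_ne_zero_iff_ne σ).mpr hx) hx]

/-- **`Gal(ℚ̄/ℚ_n) = Stab(ζ + ζ⁻¹)`, membership form.** [cite: Washington1997, §13.1 and Prop. 2.16] -/
theorem mem_layerSubgroup_two_iff_smul_add_inv (hκ : κ.IsCyclotomic)
    (hζ : IsPrimitiveRoot ζ (2 ^ (n + 2))) (σ : absoluteGaloisGroup ℚ) :
    σ ∈ κ.layerSubgroup n ↔ σ • (ζ + ζ⁻¹) = ζ + ζ⁻¹ := by
  rw [mem_layerSubgroup_two_iff hκ hζ, smul_eq_or_smul_eq_inv_iff_smul_add_inv σ (hζ.ne_zero (pow_ne_zero _ two_ne_zero))]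

/-- **`Gal(ℚ̄/ℚ_n) = Stab_{Γ_ℚ}(ζ_{2^{n+2}} + ζ_{2^{n+2}}⁻¹)`**: `ℚ_n = ℚ(ζ_{2^{n+2}} + ζ_{2^{n+2}}⁻¹) = ℚ(ζ_{2^{n+2}})⁺`.
[cite: Washington1997, §13.1] -/
theorem layerSubgroup_two_eq_stabilizer (hκ : κ.IsCyclotomic) (hζ : IsPrimitiveRoot ζ (2 ^ (n + 2))) :
    κ.layerSubgroup n = MulAction.stabilizer (absoluteGaloisGroup ℚ) (ζ + ζ⁻¹) := by
  ext σ
  rw [mem_layerSubgroup_two_iff_smul_add_inv hκ hζ, MulAction.mem_stabilizer_iff]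

/-- `Gal(ℚ̄/ℚ(ζ_{2^{n+2}})) ≤ Gal(ℚ̄/ℚ_n)` (re-derived: the stabiliser of `ζ` lies in the layer subgroup).
[cite: Washington1997, §13.1] -/
theorem stabilizer_le_layerSubgroup_two (hκ : κ.IsCyclotomic) (hζ : IsPrimitiveRoot ζ (2 ^ (n + 2))) :
    MulAction.stabilizer (absoluteGaloisGroup ℚ) ζ ≤ κ.layerSubgroup n :=
  fun σ hσ ↦ (mem_layerSubgroup_two_iff hκ hζ σ).mpr (Or.inl hσ)

end Global

/-! ## §3 Local, any `ℚ`-field `E` and any embedding `ι : ℚ̄ → Ē`: `Gal(Ē/ℚ_n·E) = {τ : τζ' = ζ'^{±1}} = Stab(ζ' + ζ'⁻¹)` -/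

section Local

/-- **Inverting one primitive `k`-th root of unity of `F̄` is inverting any other** (they are powers of each other; companion
of the tree's `smul_eq_self_iff_of_isPrimitiveRoot`). [folklore] -/
theorem smul_eq_inv_iff_of_isPrimitiveRoot {F : Type*} [Field F] {k : ℕ} [NeZero k] {μ μ' : AlgebraicClosure F}
    (hμ : IsPrimitiveRoot μ k) (hμ' : IsPrimitiveRoot μ' k) (g : absoluteGaloisGroup F) :
    g • μ = μ⁻¹ ↔ g • μ' = μ'⁻¹ := by
  obtain ⟨i, -, rfl⟩ := hμ.eq_pow_of_pow_eq_one hμ'.pow_eq_one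
  obtain ⟨j, -, hj⟩ := hμ'.eq_pow_of_pow_eq_one hμ.pow_eq_one
  constructor
  · intro h
    rw [smul_pow', h, inv_pow]
  · intro h
    calc g • μ = g • (μ ^ i) ^ j := by rw [hj]
      _ = ((μ ^ i) ^ j)⁻¹ := by rw [smul_pow', h, inv_pow]
      _ = μ⁻¹ := by rw [hj]

variable {κ : ZpExtension ℚ 2} {n : ℕ} {E : Type} [Field E] [Algebra ℚ E]
  (ι : AlgebraicClosure ℚ →ₐ[ℚ] AlgebraicClosure E)

/-- **`Gal(Ē/ℚ_n·E) = {τ : τ(ιζ) = ιζ ∨ τ(ιζ) = (ιζ)⁻¹}`** for a primitive `2^{n+2}`-th root of unity `ζ ∈ ℚ̄` transported along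
`ι` (`ι ∘ res_ι(τ) = τ ∘ ι`). [cite: Washington1997, §13.1] [cite: Kobayashi2003, Def. 1.1] -/
theorem mem_localLayerSubgroupOfEmb_two_iff_emb (hκ : κ.IsCyclotomic) {ζ : AlgebraicClosure ℚ}
    (hζ : IsPrimitiveRoot ζ (2 ^ (n + 2))) (τ : absoluteGaloisGroup E) :
    τ ∈ localLayerSubgroupOfEmb κ ι n ↔ τ • ι ζ = ι ζ ∨ τ • ι ζ = (ι ζ)⁻¹ := by
  rw [localLayerSubgroupOfEmb, mem_localSubgroupOfEmb_iff, mem_layerSubgroup_two_iff hκ hζ]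
  have h : ι (resGalOfEmb ι τ • ζ) = τ • ι ζ := apply_resGalAuxOfEmb_apply ι τ ζ
  have hinj : Function.Injective (ι : AlgebraicClosure ℚ → AlgebraicClosure E) := ι.injective
  rw [← h, ← map_inv₀ ι, hinj.eq_iff, hinj.eq_iff]

/-- **`Gal(Ē/ℚ_n·E) = {τ : τζ' = ζ' ∨ τζ' = ζ'⁻¹}` for ANY primitive `2^{n+2}`-th root of unity `ζ' ∈ Ē`**, any `ℚ`-field `E`,
any embedding `ι : ℚ̄ → Ē`, any cyclotomic `κ`. [cite: Washington1997, §13.1] [cite: Kobayashi2003, Def. 1.1] -/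
theorem mem_localLayerSubgroupOfEmb_two_iff (hκ : κ.IsCyclotomic) {ζ' : AlgebraicClosure E}
    (hζ' : IsPrimitiveRoot ζ' (2 ^ (n + 2))) (τ : absoluteGaloisGroup E) :
    τ ∈ localLayerSubgroupOfEmb κ ι n ↔ τ • ζ' = ζ' ∨ τ • ζ' = ζ'⁻¹ := by
  haveI : NeZero (2 ^ (n + 2)) := ⟨pow_ne_zero _ two_ne_zero⟩
  obtain ⟨ζ, hζ⟩ := HasEnoughRootsOfUnity.exists_primitiveRoot (AlgebraicClosure ℚ) (2 ^ (n + 2))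
  have hιζ : IsPrimitiveRoot (ι ζ) (2 ^ (n + 2)) := hζ.map_of_injective ι.injective
  rw [mem_localLayerSubgroupOfEmb_two_iff_emb ι hκ hζ, smul_eq_self_iff_of_isPrimitiveRoot hιζ hζ' τ,
    smul_eq_inv_iff_of_isPrimitiveRoot hιζ hζ' τ]

/-- `Gal(Ē/ℚ_n·E) = Stab(ζ' + ζ'⁻¹)`, membership form. [cite: Washington1997, §13.1 and Prop. 2.16] -/
theorem mem_localLayerSubgroupOfEmb_two_iff_smul_add_inv (hκ : κ.IsCyclotomic) {ζ' : AlgebraicClosure E}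
    (hζ' : IsPrimitiveRoot ζ' (2 ^ (n + 2))) (τ : absoluteGaloisGroup E) :
    τ ∈ localLayerSubgroupOfEmb κ ι n ↔ τ • (ζ' + ζ'⁻¹) = ζ' + ζ'⁻¹ := by
  rw [mem_localLayerSubgroupOfEmb_two_iff ι hκ hζ',
    smul_eq_or_smul_eq_inv_iff_smul_add_inv τ (hζ'.ne_zero (pow_ne_zero _ two_ne_zero))]

/-- **`Gal(Ē/ℚ_n·E) = Stab_{Γ_E}(ζ' + ζ'⁻¹)`**: the completion of the layer `ℚ_n` inside `Ē` is `E(ζ_{2^{n+2}} + ζ_{2^{n+2}}⁻¹)`.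
[cite: Washington1997, §13.1] [cite: Kobayashi2003, Def. 1.1] -/
theorem localLayerSubgroupOfEmb_two_eq_stabilizer (hκ : κ.IsCyclotomic) {ζ' : AlgebraicClosure E}
    (hζ' : IsPrimitiveRoot ζ' (2 ^ (n + 2))) :
    localLayerSubgroupOfEmb κ ι n = MulAction.stabilizer (absoluteGaloisGroup E) (ζ' + ζ'⁻¹) := by
  ext τ
  rw [mem_localLayerSubgroupOfEmb_two_iff_smul_add_inv ι hκ hζ', MulAction.mem_stabilizer_iff]

/-- `Stab_{Γ_E}(ζ') ≤ Gal(Ē/ℚ_n·E)` (`E(ζ_{2^{n+2}}) ⊇ ℚ_n·E`). [cite: Washington1997, §13.1] -/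
theorem stabilizer_le_localLayerSubgroupOfEmb_two (hκ : κ.IsCyclotomic) {ζ' : AlgebraicClosure E}
    (hζ' : IsPrimitiveRoot ζ' (2 ^ (n + 2))) :
    MulAction.stabilizer (absoluteGaloisGroup E) ζ' ≤ localLayerSubgroupOfEmb κ ι n :=
  fun τ hτ ↦ (mem_localLayerSubgroupOfEmb_two_iff ι hκ hζ' τ).mpr (Or.inl hτ)

/-- The other coset inverts: `τ ∈ Gal(Ē/ℚ_n·E)`, `τζ' ≠ ζ' ⟹ τζ' = ζ'⁻¹`. [cite: Washington1997, §13.1] -/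
theorem smul_eq_inv_of_mem_localLayerSubgroupOfEmb_two (hκ : κ.IsCyclotomic) {ζ' : AlgebraicClosure E}
    (hζ' : IsPrimitiveRoot ζ' (2 ^ (n + 2))) {τ : absoluteGaloisGroup E} (hτ : τ ∈ localLayerSubgroupOfEmb κ ι n)
    (hτ' : τ • ζ' ≠ ζ') : τ • ζ' = ζ'⁻¹ :=
  ((mem_localLayerSubgroupOfEmb_two_iff ι hκ hζ' τ).mp hτ).resolve_left hτ'

/-- A primitive `2^{m+2}`-th root of unity is not its own inverse (`m + 2 ≥ 2`). [folklore] -/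
theorem ne_inv_of_isPrimitiveRoot {F : Type*} [Field F] {m : ℕ} {ξ : F} (hξ : IsPrimitiveRoot ξ (2 ^ (m + 2))) :
    ξ ≠ ξ⁻¹ := by
  intro h
  have h2 : ξ ^ 2 = 1 := by
    rw [pow_two]
    nth_rw 2 [h]
    exact mul_inv_cancel₀ (hξ.ne_zero (pow_ne_zero _ two_ne_zero))
  have hdvd : 2 ^ (m + 2) ∣ 2 := (hξ.pow_eq_one_iff_dvd 2).mp h2
  have hle : 2 ^ (m + 2) ≤ 2 := Nat.le_of_dvd two_pos hdvd
  have : 4 ≤ 2 ^ (m + 2) := by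
    calc (4 : ℕ) = 2 ^ 2 := by norm_num
      _ ≤ 2 ^ (m + 2) := Nat.pow_le_pow_right two_pos (by omega)
  omega

/-- **`Stab ζ'_{2^{m+2}} ∩ Gal(Ē/ℚ_n·E) = Stab ζ'_{2^{n+2}}` (`m ≤ n`), element form**: an element of the layer-`n` subgroup
fixing `ζ'^{2^{n−m}}` (a primitive `2^{m+2}`-th root) fixes `ζ'` — it cannot invert `ζ'`, for then it would invert
`ζ'^{2^{n−m}} ≠ (ζ'^{2^{n−m}})⁻¹`. [cite: Washington1997, §13.1] -/
theorem smul_eq_self_of_smul_pow_eq_self_of_mem (hκ : κ.IsCyclotomic) {ζ' : AlgebraicClosure E}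
    (hζ' : IsPrimitiveRoot ζ' (2 ^ (n + 2))) {m : ℕ} (hmn : m ≤ n) {τ : absoluteGaloisGroup E}
    (hfix : τ • ζ' ^ 2 ^ (n - m) = ζ' ^ 2 ^ (n - m)) (hτ : τ ∈ localLayerSubgroupOfEmb κ ι n) : τ • ζ' = ζ' := by
  by_contra hne
  have hinv := smul_eq_inv_of_mem_localLayerSubgroupOfEmb_two ι hκ hζ' hτ hne
  have hξ : IsPrimitiveRoot (ζ' ^ 2 ^ (n - m)) (2 ^ (m + 2)) :=
    hζ'.pow (pow_pos two_pos _) (by rw [← pow_add]; congr 1; omega)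
  refine ne_inv_of_isPrimitiveRoot hξ ?_
  conv_lhs => rw [← hfix, smul_pow', hinv, inv_pow]

end Local

end Summit.BirchSwinnertonDyer.BirchSwinnertonDyer.Theorems.SignedEC.PlusLayer

end
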